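import Summits.QuantumFields.YangMills.Theorems.BalabanUVNodesN15KingModelTranslationCovarianceGraphs
import Summits.QuantumFields.YangMills.Theorems.BalabanUVNodesN15KingModelGraphTreeDecayContinuumDensity
import Summits.QuantumFields.YangMills.Theorems.BalabanUVNodesN15KingModelGraphTreeDecayContinuumNE2
import Summits.QuantumFields.YangMills.Theorems.BalabanUVNodesN15KingModelGraphTreeDecayContinuumFields
import Summits.QuantumFields.YangMills.Theorems.BalabanUVNodesN15KingModelGraphTreeDecayContinuumLegs

/-!
# BalabanUVNodes ∕ N15 — THE KING-MODEL RUNG (PART Ϙ-d): TRANSLATION INVARIANCE ALONG `K` AND IN THE LIMIT `K → ∞` — THE VACUUM ENERGY DENSITY IS ONE PINNED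
# DIAGRAM (EXACTLY, AT EVERY `K`), THE FIELD-PAIRED DIAGRAM IS INVARIANT UNDER TRANSLATING THE FIELD, AND THE CONTINUUM TWO-POINT ∕ n-POINT KERNELS OF PARTS
# Β-e∕Β-f∕Β-h ARE TRANSLATION INVARIANT (`E^{(∞)}(G; b + v, b′ + v) = E^{(∞)}(G; b, b′)`)
# (Track A, DAG node N15 = NE2; FAN-OUT v1.1 §N15 s3 «KING-MODEL RUNG … NE2's analogue DECIDED in the model»)

HONEST FRAMING.  Count-neutral (cell `pub-ymgap`, seat `pub-ymgap-dag-n15-e` g31; `--supports stmt-QuantumFields-27366 --as helper` = K3⁸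
`SpineGivenEndpointR13SepCoPHV`).  TEMPLATE LITERATURE: C. King, *The U(1) Higgs model. I. The continuum limit*, Commun. Math. Phys. **102** (1986) 649–677
[King1986] — KING's OWN `A = 0` MODEL on the rung's tori `2L^{e_M}` with `K + 1` scales (parts Β-d…Β-j's objects `kingVacuumSeq`, `kingVacuumDensity`, `kingPairSeq`,
`kingPairLim`, `kingGraphLimUnit`, `kingFieldSeq`, `kingLegSeq`).  NOT Bałaban's `G(U)`; NOT a node discharge (N15 is booked through n15-a's knit, untouched here);
nothing continuum ∕ ℝ⁴ ∕ OS ∕ mass-gap ∕ Clay — «continuum kernel» means the `K → ∞` limit of King's lattice diagrams at FIXED unit lattice, Theorem 2.1's `lim_{κ→∞}`,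
as in parts Β-d…Β-j.  0 `sorry`; standard axioms.  Sequel of part Ϙ-c (`…TranslationCovarianceGraphs`).

THE PRINT.  Theorem 2.1 (2.22)–(2.23) p. 654: the limits `lim_{κ→∞}` of the effective densities exist and `|ln Z| ≤ C|T|`; p. 659 «E₁ is represented by a sum of
vacuum energy diagrams»; Lemma 4.5 (4.38) p. 674 and the plane-wave representation (4.1)–(4.5) p. 670 (translation invariance of every `A = 0` kernel on the torus).
What this file adds to parts Β-d…Β-j: the IDENTITIES behind their volume-free bounds — the density `e_K(G) = E^{(K+1)}(G)∕|T^{(K)}|` is not merely bounded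
independently of the volume, it IS the diagram pinned at any one block; and the `K → ∞` kernels inherit translation invariance from every finite `K`.

WHAT THIS FILE PROVES (kernel; 0 `def`).  §1 ★★ `kingVacuumSeq_eq_card_mul_pinned` (`E^{(K+1)}(G) = |T^{(K)}|·E^{(K+1)}(G; χ_{b₀})`), ★★★ **`kingVacuumDensity_eq_pinned`**
(the vacuum energy density of part Β-f₁ IS the diagram pinned at ANY block `b₀`, at every `K`, hypothesis-free — hence its `K → ∞` limit is the limit of one pinned
diagram).  §2 ★★ `kingPairSeq_transl`, ★★★ **`kingPairLim_transl`** (THE CONTINUUM TWO-POINT KERNEL IS TRANSLATION INVARIANT: `E^{(∞)}(G; b + v, b′ + v) =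
E^{(∞)}(G; b, b′)` — no convergence hypothesis: the defining sequences coincide), ★★ `kingGraphLimUnit_transl` (NE2's unit-layer kernel against the continuum kernel,
part Β-f₂, is translation invariant).  §3 ★★ `kingFieldSeq_transl` (the diagram paired with a unit-lattice field is invariant under translating the field:
`E^{(K+1)}(G; φ∘τ_v) = E^{(K+1)}(G; φ)` — homogeneity of King's effective-action terms (3.40) at `A = 0`).  §4 ★★ `kingLegSeq_transl` (n-point kernels along `K`),
★★★ **`tendsto_kingLegSeq_transl_iff`** ∕ `king_graphLegs_limit_transl` (the continuum n-point kernel of parts Β-h∕Β-i∕Β-j at the translated sites `{b_υ + v}` is the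
same number as at `{b_υ}`).

HONEST SCOPE.  Torus ∕ periodic b.c., flat block mean, `A = 0` (part Ϙ-a HONEST SCOPE); identities only — the rates, decay and tree-decay statements remain those of
parts Β-d…Β-j.  N15 untouched; counts unmoved.
Locators: [King1986] Thm 2.1 (2.22)–(2.23) p.654, (3.35) p.659, (3.36)–(3.37) p.660, (3.40) p.660, Prop. 3.6 (3.56) p.662, Prop. 3.8 (3.71) p.664, (4.1)–(4.5) p.670, Lemma 4.5 (4.38) p.674.
-/

noncomputable section

open scoped BigOperators Topology
open Finset Filter Matrix

namespace Summit.QuantumFields.YangMills.BalabanUVNodes.N15KingModelRung.Curved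

open Literature.MathematicalPhysics.QuantumFieldTheory.Balaban1983to89.B5Prop11Plancherel (Tor fine)
open Literature.MathematicalPhysics.QuantumFieldTheory.Balaban1983to89 (B5Block118.up B5Block118.up_add)
open Literature.MathematicalPhysics.QuantumFieldTheory.King1986.Torus
open Summit.QuantumFields.YangMills.BalabanUVNodes.N15KingModelRung
open Summit.QuantumFields.YangMills.BalabanUVNodes.N15KingModelRung.Transl
open Summit.QuantumFields.YangMills.BalabanUVNodes.N15KingModelRung.Graph

variable {d : ℕ} (L : ℕ) [NeZero L]

/-! ## §1 The vacuum amplitude and the vacuum energy density along `K` -/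

section Vacuum

variable (a msq : ℝ) (eM : ℕ) {nn m : ℕ} (src tgt : Fin m → Fin (nn + 1)) (κ : Fin m → Option (Fin (d + 1)))

/-- ★★ **`E^{(K+1)}(G) = |T^{(K)}| · E^{(K+1)}(G; χ_{b₀})`** for the vacuum amplitude along `K` (part Β-d's `kingVacuumSeq`), every block `b₀`, every `K`, hypothesis-free.
[cite: King1986, (3.35) p.659, (3.36)–(3.37) p.660] -/
theorem kingVacuumSeq_eq_card_mul_pinned (b₀ : Tor (kingVol L (jvSucc (d := d) eM 0))) (K : ℕ) :
    haveI := kingVol_neZero L (jvSucc (d := d) eM K)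
    kingVacuumSeq L a msq eM nn m src tgt κ K
      = (Fintype.card (Tor (kingVol L (jvSucc (d := d) eM K))) : ℝ) *
        graphValLS ((((L : ℝ) ^ (K + 1))⁻¹) ^ (d + 1)) src tgt (fun ℓ => kingGLine L (kingVol L (jvSucc (d := d) eM K)) a msq (K + 1) (κ ℓ))
          (fun _ : Unit => (0 : Fin (nn + 1))) (fun _ => blockIndLo L (jvSucc (d := d) eM K) b₀) :=
  king_vacuum_graph_eq_card_mul_pinned L a msq (jvSucc (d := d) eM K) src tgt κ 0 b₀

/-- ★★★ **THE VACUUM ENERGY DENSITY IS ONE PINNED DIAGRAM**: `e_K(G) = E^{(K+1)}(G)∕|T^{(K)}| = E^{(K+1)}(G; χ_{b₀})` for EVERY block `b₀` and every `K` — so part Β-f₁'s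
volume-free limit `lim_K e_K(G)` is the `K → ∞` limit of the diagram pinned at one block, and its volume-independence is an identity, not only a bound.
[cite: King1986, Thm 2.1 (ii) (2.23) p.654, (3.35) p.659, (3.36)–(3.37) p.660] -/
theorem kingVacuumDensity_eq_pinned (b₀ : Tor (kingVol L (jvSucc (d := d) eM 0))) (K : ℕ) :
    haveI := kingVol_neZero L (jvSucc (d := d) eM K)
    kingVacuumDensity L a msq eM nn m src tgt κ K
      = graphValLS ((((L : ℝ) ^ (K + 1))⁻¹) ^ (d + 1)) src tgt (fun ℓ => kingGLine L (kingVol L (jvSucc (d := d) eM K)) a msq (K + 1) (κ ℓ))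
          (fun _ : Unit => (0 : Fin (nn + 1))) (fun _ => blockIndLo L (jvSucc (d := d) eM K) b₀) := by
  haveI := kingVol_neZero L (jvSucc (d := d) eM K)
  have hcard : (Fintype.card (Tor (kingVol L (jvSucc (d := d) eM K))) : ℝ) = (2 * (L : ℝ) ^ eM) ^ (d + 1) := by
    rw [card_unitTorus]; push_cast; rfl
  have hne : (2 * (L : ℝ) ^ eM) ^ (d + 1) ≠ 0 :=
    pow_ne_zero _ (mul_ne_zero two_ne_zero (pow_ne_zero _ (Nat.cast_ne_zero.mpr (NeZero.ne L))))
  unfold kingVacuumDensity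
  rw [kingVacuumSeq_eq_card_mul_pinned L a msq eM src tgt κ b₀ K, hcard, mul_div_cancel_left₀ _ hne]

end Vacuum

/-! ## §2 The two-point kernel along `K` and its `K → ∞` limit -/

section Pair

variable (a msq : ℝ) (eM : ℕ) {nn m : ℕ} (src tgt : Fin m → Fin (nn + 1)) (κ : Fin m → Option (Fin (d + 1))) (v₁ : Fin (nn + 1))
  (κ₀ κ₁ : Option (Fin (d + 1)))

/-- ★★ **THE TWO-POINT KERNEL ALONG `K` DEPENDS ON `b − b′` ONLY**: `E^{(K+1)}(G; y_{b+v}, y_{b′+v}) = E^{(K+1)}(G; y_b, y_{b′})`. [cite: King1986, Prop. 3.6 (3.56) p.662, Prop. 3.8 (3.71) p.664, (4.1)–(4.2) p.670] -/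
theorem kingPairSeq_transl (b b' v : Tor (kingVol L (jvSucc (d := d) eM 0))) (K : ℕ) :
    kingPairSeq L a msq eM nn m src tgt κ v₁ κ₀ κ₁ (b + v) (b' + v) K = kingPairSeq L a msq eM nn m src tgt κ v₁ κ₀ κ₁ b b' K := by
  unfold kingPairSeq
  rw [vecCons_add_const]
  exact king_graph_legsLo_transl L a msq (jvSucc (d := d) eM K) src tgt κ _ ![(0 : Fin (nn + 1)), v₁] ![b, b'] ![κ₀, κ₁] v

/-- ★★★ **THE CONTINUUM TWO-POINT KERNEL IS TRANSLATION INVARIANT**: `E^{(∞)}(G; b + v, b′ + v) = E^{(∞)}(G; b, b′)` (part Β-f₂'s `kingPairLim`; no convergence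
hypothesis — the defining sequences coincide term by term). [cite: King1986, Thm 2.1 (i) (2.22) p.654, Lemma 4.5 (4.38) p.674, (4.1)–(4.5) p.670] -/
theorem kingPairLim_transl (b b' v : Tor (kingVol L (jvSucc (d := d) eM 0))) :
    kingPairLim L a msq eM nn m src tgt κ v₁ κ₀ κ₁ (b + v) (b' + v) = kingPairLim L a msq eM nn m src tgt κ v₁ κ₀ κ₁ b b' := by
  unfold kingPairLim
  rw [show kingPairSeq L a msq eM nn m src tgt κ v₁ κ₀ κ₁ (b + v) (b' + v) = kingPairSeq L a msq eM nn m src tgt κ v₁ κ₀ κ₁ b b' from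
    funext fun K => kingPairSeq_transl L a msq eM src tgt κ v₁ κ₀ κ₁ b b' v K]

/-- ★★ **NE2's UNIT-LAYER KERNEL AGAINST THE CONTINUUM KERNEL IS TRANSLATION INVARIANT** (part Β-f₂'s `kingGraphLimUnit` on the family `(e_M, K)`):
`k_{(e_M,K)}(U; b + v, b′ + v) = k_{(e_M,K)}(U; b, b′)`. [cite: King1986, Lemma 4.5 (4.38) p.674, (4.1)–(4.5) p.670] -/
theorem kingGraphLimUnit_transl (p : ℕ × ℕ) (U : (kingVolInstance d L (jvSucc (d := d) p.1 p.2)).Bf.Cfg)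
    (b b' v : Tor (kingVol L (jvSucc (d := d) p.1 0))) :
    (kingGraphLimUnit L a msq nn m src tgt κ v₁ κ₀ κ₁ p).ker U (b + v) (b' + v) = (kingGraphLimUnit L a msq nn m src tgt κ v₁ κ₀ κ₁ p).ker U b b' := by
  show kingPairSeq L a msq p.1 nn m src tgt κ v₁ κ₀ κ₁ (b + v) (b' + v) p.2 - kingPairLim L a msq p.1 nn m src tgt κ v₁ κ₀ κ₁ (b + v) (b' + v)
      = kingPairSeq L a msq p.1 nn m src tgt κ v₁ κ₀ κ₁ b b' p.2 - kingPairLim L a msq p.1 nn m src tgt κ v₁ κ₀ κ₁ b b'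
  rw [kingPairSeq_transl, kingPairLim_transl]

end Pair

/-! ## §3 The diagram paired with a unit-lattice field: invariance under translating the field -/

section Field

variable (a msq : ℝ) (eM : ℕ) {nn m : ℕ} (src tgt : Fin m → Fin (nn + 1)) (κ : Fin m → Option (Fin (d + 1))) (κ₀ : Option (Fin (d + 1)))
  {r : ℕ} (vtxF : Fin r → Fin (nn + 1)) (κF : Fin r → Option (Fin (d + 1)))

/-- ★ **THE FIELD-PAIRED DOUBLE SUM IS INVARIANT UNDER TRANSLATING THE FIELD** (one carrier `jv`, any weight): re-index the field sites `y₀ ↦ y₀ + v`, `w ↦ w + v`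
and translate every leg by `v` (part Ϙ-c `king_graph_legsLo_transl`). [cite: King1986, (3.40) p.660, Prop. 3.8 (3.71) p.664, (4.1)–(4.2) p.670] -/
theorem king_graph_fieldSum_transl (jv : KingVolIndex d) (wt : ℝ) (φ : Tor (kingVol L jv) → ℝ) (v : Tor (kingVol L jv)) :
    haveI := kingVol_neZero L jv
    (∑ y₀ : Tor (kingVol L jv), ∑ w : Fin r → Tor (kingVol L jv), (φ (y₀ + v) * ∏ l, φ (w l + v))
        * graphValLS wt src tgt (fun ℓ => kingGLine L (kingVol L jv) a msq jv.K (κ ℓ)) (Sum.elim (fun _ : Unit => (0 : Fin (nn + 1))) vtxF)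
            (fun υ => kingExtLo L a msq jv (Sum.elim (fun _ : Unit => y₀) w υ) (Sum.elim (fun _ : Unit => κ₀) κF υ)))
      = ∑ y₀ : Tor (kingVol L jv), ∑ w : Fin r → Tor (kingVol L jv), (φ y₀ * ∏ l, φ (w l))
        * graphValLS wt src tgt (fun ℓ => kingGLine L (kingVol L jv) a msq jv.K (κ ℓ)) (Sum.elim (fun _ : Unit => (0 : Fin (nn + 1))) vtxF)
            (fun υ => kingExtLo L a msq jv (Sum.elim (fun _ : Unit => y₀) w υ) (Sum.elim (fun _ : Unit => κ₀) κF υ)) := by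
  haveI := kingVol_neZero L jv
  refine Fintype.sum_equiv (Equiv.addRight v) _ _ fun y₀ => ?_
  refine Fintype.sum_equiv (Equiv.addRight (fun _ : Fin r => v)) _ _ fun w => ?_
  simp only [Equiv.coe_addRight, Pi.add_apply]
  refine congrArg (fun E : ℝ => (φ (y₀ + v) * ∏ l, φ (w l + v)) * E) ?_
  rw [show (fun υ => kingExtLo L a msq jv (Sum.elim (fun _ : Unit => y₀ + v) (w + fun _ : Fin r => v) υ) (Sum.elim (fun _ : Unit => κ₀) κF υ))
      = fun υ => kingExtLo L a msq jv (Sum.elim (fun _ : Unit => y₀) w υ + v) (Sum.elim (fun _ : Unit => κ₀) κF υ) from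
      funext fun υ => by rcases υ with _ | _ <;> rfl]
  exact (king_graph_legsLo_transl L a msq jv src tgt κ wt _ _ _ v).symm

/-- ★★ **THE FIELD-PAIRED DIAGRAM IS INVARIANT UNDER TRANSLATING THE FIELD**: `E^{(K+1)}(G; φ∘τ_v) = E^{(K+1)}(G; φ)` for part Β-g's `kingFieldSeq` (the diagram's legs summed
against `φ(y₀)Π_lφ(w_l)`) — the `A = 0` shadow of the homogeneity of King's effective-action terms (3.40). [cite: King1986, (3.40) p.660, Prop. 3.8 (3.71) p.664, (4.1)–(4.2) p.670] -/
theorem kingFieldSeq_transl (φ : Tor (kingVol L (jvSucc (d := d) eM 0)) → ℝ) (v : Tor (kingVol L (jvSucc (d := d) eM 0))) (K : ℕ) :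
    kingFieldSeq L a msq eM nn m src tgt κ κ₀ r vtxF κF (fun y => φ (y + v)) K = kingFieldSeq L a msq eM nn m src tgt κ κ₀ r vtxF κF φ K := by
  unfold kingFieldSeq
  exact king_graph_fieldSum_transl L a msq src tgt κ κ₀ vtxF κF (jvSucc (d := d) eM K) _ φ v

end Field

/-! ## §4 The n-point kernels along `K` and their `K → ∞` limits -/

section Legs

variable (a msq : ℝ) (eM : ℕ) {nn m : ℕ} (src tgt : Fin m → Fin (nn + 1)) (κ : Fin m → Option (Fin (d + 1)))
  (Υ : Type) [Fintype Υ] (vtx : Υ → Fin (nn + 1)) (b : Υ → Tor (kingVol L (jvSucc (d := d) eM 0))) (κe : Υ → Option (Fin (d + 1)))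
  (v : Tor (kingVol L (jvSucc (d := d) eM 0)))

/-- ★★ **THE n-POINT KERNEL ALONG `K` IS TRANSLATION INVARIANT**: `E^{(K+1)}(G; {y_{b_υ + v}}) = E^{(K+1)}(G; {y_{b_υ}})`. [cite: King1986, Prop. 3.6 (3.56) p.662, Prop. 3.8 (3.71) p.664, (4.1)–(4.2) p.670] -/
theorem kingLegSeq_transl (K : ℕ) :
    kingLegSeq L a msq eM nn m src tgt κ Υ vtx (fun υ => b υ + v) κe K = kingLegSeq L a msq eM nn m src tgt κ Υ vtx b κe K := by
  unfold kingLegSeq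
  exact king_graph_legsLo_transl L a msq (jvSucc (d := d) eM K) src tgt κ _ vtx b κe v

/-- ★★★ **THE CONTINUUM n-POINT KERNEL IS TRANSLATION INVARIANT**: the sequence at the translated sites `{b_υ + v}` converges to `E` iff the sequence at `{b_υ}` does —
so the limit of parts Β-h∕Β-i∕Β-j (`king_graphLegs_continuumLimit{,_tree,_inf}`) is the same number at `{b_υ + v}`. [cite: King1986, Thm 2.1 (i) (2.22) p.654, (4.1)–(4.5) p.670] -/
theorem tendsto_kingLegSeq_transl_iff (E : ℝ) :
    Tendsto (kingLegSeq L a msq eM nn m src tgt κ Υ vtx (fun υ => b υ + v) κe) atTop (𝓝 E)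
      ↔ Tendsto (kingLegSeq L a msq eM nn m src tgt κ Υ vtx b κe) atTop (𝓝 E) := by
  rw [show kingLegSeq L a msq eM nn m src tgt κ Υ vtx (fun υ => b υ + v) κe = kingLegSeq L a msq eM nn m src tgt κ Υ vtx b κe from
    funext fun K => kingLegSeq_transl L a msq eM src tgt κ Υ vtx b κe v K]

/-- ★★ **… in particular the `limUnder` of the translated sequence is the `limUnder` of the original one** (whatever the convergence status). [cite: King1986, Thm 2.1 (i) (2.22) p.654] -/
theorem king_graphLegs_limit_transl :
    limUnder atTop (kingLegSeq L a msq eM nn m src tgt κ Υ vtx (fun υ => b υ + v) κe)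
      = limUnder atTop (kingLegSeq L a msq eM nn m src tgt κ Υ vtx b κe) := by
  rw [show kingLegSeq L a msq eM nn m src tgt κ Υ vtx (fun υ => b υ + v) κe = kingLegSeq L a msq eM nn m src tgt κ Υ vtx b κe from
    funext fun K => kingLegSeq_transl L a msq eM src tgt κ Υ vtx b κe v K]

end Legs

end Summit.QuantumFields.YangMills.BalabanUVNodes.N15KingModelRung.Curved

end
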